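import Summits.ResolutionOfSingularities.ResolutionOfSingularities.Theorems.EquisingularLiftEquisingularLiftNatEBetaVertex
import Summits.ResolutionOfSingularities.ResolutionOfSingularities.Theorems.EquisingularLiftEquisingularLiftNatSpecimenQuarticPointStep
import Literature.AlgebraicGeometry.Resolution.NodalPowRingSingularLocus
import HarnessLib

/-!
# [OURS · L1 W4.5(b)] T-ISO-1 algebra layer, III: the singular chart `z² + x⁴ + y⁴` is non-regular EXACTLY at the origin

Helper for the research stub `stub_elnat_three_isolated_nonabs` / rung T-ISO-0⁺ (`stub_elnat_tcDeltaPointResolution`) of the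
crux `EquisingularLiftNat` (stmt-ResolutionOfSingularities-20038; route `EquisingularLift`, chain w45b, CHAIN v7.4 §3 row
T-ISO-1). NOT a statement of any manuscript; AI-written kernel lemma of the cell `res-hironaka` (weaker than expert review).

The rungs T-ISO-0 / T-ISO-0⁺ consume, downstairs, «`x` a CLOSED NON-REGULAR point of the strict transform» and «the
non-regular locus is finite». For the quartic specimen `H = V(x₀²x₃² + x₁⁴ + x₂⁴)` (`char k ≠ 2`) the two singular charts
are `V(f)`, `f = z² + x⁴ + y⁴ = X 2² + X 0⁴ + X 1⁴ ∈ A = k[x, y, z]` (`fSing` of the forms layer), and this file pins the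
non-regular locus of `A/(f)` at ring level:

* `f_mem_origin_sq`, **`not_isRegularLocalRing_origin`** — at the origin `𝔪₀ = (x, y, z)`: `f ∈ 𝔪₀²` is a non-zero-divisor,
  so `A_{𝔪₀}/(f)` is NOT regular (Matsumura 14.2, tree `not_isRegularLocalRing_quotient_span_singleton_of_mem_sq'`);
* **`isRegularLocalRing_of_not_origin`** — at every other prime `Q ∋ f` (some `X i ∉ Q`): one of `∂ₓf = 4x³`,
  `∂_yf = 4y³`, `∂_zf = 2z` lies outside `Q`, so `A_Q/(f)` IS regular (Stacks 07PF, local form of part 0);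
* **`isRegularLocalRing_iff_not_origin`** — the dichotomy.

With the smooth charts (`isRegularRing_quotient_smoothChart`, p510354) this says: `Sing H` = the two points `[0:0:0:1]`,
`[1:0:0:0]` (the charts `x₀ = 1`, `x₃ = 1` being the same polynomial up to `x ↔ z`), at ring level.

References: H. Matsumura, *Commutative Ring Theory*, Thm. 14.2; The Stacks Project, Tag 07PF — through the cited tree files.
-/

set_option linter.dupNamespace false -- mandated namespace `Summit.<Summit>.<Problem>` of this single-conjunct summit

noncomputable section

open MvPolynomial IsLocalRing
open Literature.AlgebraicGeometry.Resolution
open Summit.ResolutionOfSingularities.ResolutionOfSingularities.Theorems.EquisingularLift.EBeta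

namespace Summit.ResolutionOfSingularities.ResolutionOfSingularities.Theorems.EquisingularLift.SpecimenQuartic

variable (k : Type) [Field k]

/-- `f = z² + x⁴ + y⁴` lies in `Q²` for every ideal `Q ∋ x, y, z`. [folklore] -/
theorem f_mem_sq_of_forall_X_mem (Q : Ideal (MvPolynomial (Fin 3) k))
    (hX : ∀ i : Fin 3, (X i : MvPolynomial (Fin 3) k) ∈ Q) :
    (X 2 ^ 2 + X 0 ^ 4 + X 1 ^ 4 : MvPolynomial (Fin 3) k) ∈ Q ^ 2 := by
  rw [pow_two]
  refine Ideal.add_mem _ (Ideal.add_mem _ ?_ ?_) ?_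
  · rw [pow_two]; exact Ideal.mul_mem_mul (hX 2) (hX 2)
  · rw [show (X 0 ^ 4 : MvPolynomial (Fin 3) k) = X 0 * X 0 ^ 3 by ring]
    exact Ideal.mul_mem_mul (hX 0) (Q.pow_mem_of_mem (hX 0) 3 (by norm_num))
  · rw [show (X 1 ^ 4 : MvPolynomial (Fin 3) k) = X 1 * X 1 ^ 3 by ring]
    exact Ideal.mul_mem_mul (hX 1) (Q.pow_mem_of_mem (hX 1) 3 (by norm_num))

/-- `f ≠ 0` (its `z²`-coefficient is `1`). [folklore] -/
theorem f_ne_zero : (X 2 ^ 2 + X 0 ^ 4 + X 1 ^ 4 : MvPolynomial (Fin 3) k) ≠ 0 := by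
  intro h
  classical
  have hc := congrArg (MvPolynomial.coeff (Finsupp.single (2 : Fin 3) 2)) h
  rw [coeff_add, coeff_add, coeff_X_pow, if_pos rfl, coeff_X_pow, if_neg, coeff_X_pow, if_neg, coeff_zero] at hc
  · simp at hc
  · intro h0
    have := congrArg (fun e : Fin 3 →₀ ℕ => e 2) h0
    simp at this
  · intro h0
    have := congrArg (fun e : Fin 3 →₀ ℕ => e 2) h0
    simp at this

/-- **At a prime containing `x, y, z` (the origin), `V(z² + x⁴ + y⁴)` is NOT regular**: `A_Q/(f)` is not a regular
local ring (`f` a non-zero-divisor in `Q²A_Q`, Matsumura 14.2). [OURS · T-ISO-1 algebra] -/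
theorem not_isRegularLocalRing_of_forall_X_mem (Q : Ideal (MvPolynomial (Fin 3) k)) [Q.IsPrime]
    (hX : ∀ i : Fin 3, (X i : MvPolynomial (Fin 3) k) ∈ Q) :
    ¬ IsRegularLocalRing (Localization.AtPrime Q ⧸
      Ideal.span {algebraMap (MvPolynomial (Fin 3) k) (Localization.AtPrime Q) (X 2 ^ 2 + X 0 ^ 4 + X 1 ^ 4)}) := by
  apply not_isRegularLocalRing_quotient_span_singleton_of_mem_sq'
  · apply mem_nonZeroDivisors_of_ne_zero
    intro h0
    have hinj := IsLocalization.injective (Localization.AtPrime Q) Q.primeCompl_le_nonZeroDivisors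
    rw [← map_zero (algebraMap (MvPolynomial (Fin 3) k) (Localization.AtPrime Q))] at h0
    exact f_ne_zero k (hinj h0)
  · rw [← Localization.AtPrime.map_eq_maximalIdeal, ← Ideal.map_pow]
    exact Ideal.mem_map_of_mem _ (f_mem_sq_of_forall_X_mem k Q hX)

/-- The origin ideal `𝔪₀ = (x, y, z)` is prime (`A/𝔪₀ ≅ k`). [folklore] -/
theorem isPrime_origin : (PointBlowup.originIdeal 2 k).IsPrime := by
  haveI := isDomain_quotient_origin k
  exact (Ideal.Quotient.isDomain_iff_prime _).mp inferInstance

/-- **The origin is a non-regular point of `V(z² + x⁴ + y⁴)`.** [OURS · T-ISO-1 algebra] -/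
theorem not_isRegularLocalRing_origin :
    letI := isPrime_origin k
    ¬ IsRegularLocalRing (Localization.AtPrime (PointBlowup.originIdeal 2 k) ⧸
      Ideal.span {algebraMap (MvPolynomial (Fin 3) k) (Localization.AtPrime (PointBlowup.originIdeal 2 k))
        (X 2 ^ 2 + X 0 ^ 4 + X 1 ^ 4)}) := by
  letI := isPrime_origin k
  exact not_isRegularLocalRing_of_forall_X_mem k _ fun i => Ideal.subset_span (Set.mem_range_self i)

/-- The three partials of `f = z² + x⁴ + y⁴`. [folklore] -/
theorem pderiv_f :
    (pderiv 0 : Derivation k (MvPolynomial (Fin 3) k) _) (X 2 ^ 2 + X 0 ^ 4 + X 1 ^ 4) = 4 * X 0 ^ 3 ∧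
      (pderiv 1 : Derivation k (MvPolynomial (Fin 3) k) _) (X 2 ^ 2 + X 0 ^ 4 + X 1 ^ 4) = 4 * X 1 ^ 3 ∧
      (pderiv 2 : Derivation k (MvPolynomial (Fin 3) k) _) (X 2 ^ 2 + X 0 ^ 4 + X 1 ^ 4) = 2 * X 2 := by
  refine ⟨?_, ?_, ?_⟩ <;> simp [Derivation.leibniz_pow]

/-- **Off the origin `V(z² + x⁴ + y⁴)` is regular** (`char k ≠ 2`): at a prime `Q ∋ f` not containing all of `x, y, z`
one of the partials `4x³, 4y³, 2z` lies outside `Q`, so `A_Q/(f)` is a regular local ring (Stacks 07PF, local form).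
[OURS · T-ISO-1 algebra] -/
theorem isRegularLocalRing_of_not_origin (h2 : IsUnit (2 : k)) (Q : Ideal (MvPolynomial (Fin 3) k)) [hQ : Q.IsPrime]
    (hfQ : (X 2 ^ 2 + X 0 ^ 4 + X 1 ^ 4 : MvPolynomial (Fin 3) k) ∈ Q)
    (hne : ∃ i : Fin 3, (X i : MvPolynomial (Fin 3) k) ∉ Q) :
    IsRegularLocalRing (Localization.AtPrime Q ⧸
      Ideal.span {algebraMap (MvPolynomial (Fin 3) k) (Localization.AtPrime Q) (X 2 ^ 2 + X 0 ^ 4 + X 1 ^ 4)}) := by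
  have h2A : IsUnit (2 : MvPolynomial (Fin 3) k) := by
    have h := h2.map (C : k →+* MvPolynomial (Fin 3) k)
    rwa [map_ofNat] at h
  obtain ⟨i, hi⟩ := hne
  obtain ⟨hd0, hd1, hd2⟩ := pderiv_f k
  -- the derivation `∂/∂x_i` certifies
  refine isRegularLocalRing_quotient_of_derivation _ (pderiv i) Q hfQ ?_
  match i with
  | 0 =>
    rw [hd0]
    exact fun h => hi (hQ.mem_of_pow_mem 3 (mem_of_four_mul_mem hQ h2A h))
  | 1 =>
    rw [hd1]
    exact fun h => hi (hQ.mem_of_pow_mem 3 (mem_of_four_mul_mem hQ h2A h))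
  | 2 =>
    rw [hd2]
    exact fun h => hi (mem_of_two_mul_mem hQ h2A h)

/-- **The non-regular locus of `V(z² + x⁴ + y⁴)` is exactly the origin** (`char k ≠ 2`): for a prime `Q ∋ f`,
`A_Q/(f)` is regular iff `Q` does not contain all three coordinates. [OURS · T-ISO-1 algebra] -/
theorem isRegularLocalRing_iff_not_origin (h2 : IsUnit (2 : k)) (Q : Ideal (MvPolynomial (Fin 3) k)) [hQ : Q.IsPrime]
    (hfQ : (X 2 ^ 2 + X 0 ^ 4 + X 1 ^ 4 : MvPolynomial (Fin 3) k) ∈ Q) :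
    IsRegularLocalRing (Localization.AtPrime Q ⧸
      Ideal.span {algebraMap (MvPolynomial (Fin 3) k) (Localization.AtPrime Q) (X 2 ^ 2 + X 0 ^ 4 + X 1 ^ 4)}) ↔
      ∃ i : Fin 3, (X i : MvPolynomial (Fin 3) k) ∉ Q := by
  refine ⟨fun hreg => ?_, isRegularLocalRing_of_not_origin k h2 Q hfQ⟩
  by_contra hall
  simp only [not_exists, not_not] at hall
  exact not_isRegularLocalRing_of_forall_X_mem k Q hall hreg

end Summit.ResolutionOfSingularities.ResolutionOfSingularities.Theorems.EquisingularLift.SpecimenQuartic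

end
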